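import Literature.NumberTheory.Rogawski1990.LocalNormFibreBadFrame      -- ★ p842076 F0P3a-p08: the bad frame (+ B3-alg chain: `twistGram`, `finSum`, FILE 1 rigidity)
import HarnessLib

/-!
# Classes realised in the bad frame: frame ⇒ unitary block, block rigidity under conjugation, and block ⇒ unitary element (Rogawski 1990, §8.1 Prop. 8.1.3 pp. 110–111:
# «the groups `I(j)` are inner forms …»; §3.8 Prop. 3.8.1 (d)) — the generic layer of the matched-class COUNT `hcnt` ((CNT-a) «frame bijection»)

Topic `NumberTheory/Rogawski1990`; namespace `Literature.NumberTheory.Rogawski1990`.  THEOREMS ONLY (no definition, no instance, no notation, no named fact, no `sorry`).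
Cell `pub/hodgecm-mathlib` (D-0151), crux H413 = stmt-HodgeConjecture-24833, floor-2 line «N6nsGerm», binder `hcnt` of B-p08 (g27)'s ★ compact-side junction
`exists_nhds_finsum_side_eq_stableOrbitalIntegralRel_of_compact_dock` (p842024) read through F0P3a-p08's `Q′ γH γ := ∃ B, γ·P′ = P′·(B ⊕ᶠ γ₂(γH)•1)` (★ `side_of_dock`); brick
**(CNT-a)** (LEAD F0P3a-plan (g9) T8-118; B-p12 (g28) CENSUS-CNT finding (1)); seat F0P3a-p08 (g13).  HONEST LABEL: HC_CM is proved only modulo the printed citations until rung 0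
closes; ring-generic linear algebra, no letter.

THE MATHEMATICS (any commutative ring `S` with involution `σ`, `H` with a frame `P` of block-diagonal Gram matrix `ᵗ(σP)HP = G₁ ⊕ᶠ G₂`).
* §1 FRAME ⇒ BLOCKS: if `γ ∈ U(H)` and `γP = P(B ⊕ᶠ C)` then `B ∈ U(G₁)`, `C ∈ U(G₂)` (`twistGram_blocks_of_frame`) and `det B`, `det C` are units (`isUnit_det_blocks_of_frame`).
* §2 RIGIDITY: if `k(B ⊕ᶠ b) = (B₂ ⊕ᶠ b)k` with `χ_B(b)`, `χ_{B₂}(b)` units, then `k = k₁ ⊕ᶠ k₂` is block diagonal and `k₁B = B₂k₁` (`exists_finSum_eq_of_mul_finSum_eq`) — the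
  off-diagonal blocks are row∕column eigenvectors for the eigenvalue `b`, killed by ★ `eq_zero_of_mul_eq_smul_of_isUnit_eval_charpoly`.  Hence two realisations
  `xγx⁻¹ = P(B ⊕ᶠ b)P⁻¹`, `x′γ′x′⁻¹ = P(B₂ ⊕ᶠ b)P⁻¹` of `U(H)`-conjugate `γ ~ γ′` have `U(G₁)`-conjugate blocks (`exists_unitary_block_conj_of_conj`).
* §3 BLOCKS ⇒ ELEMENT: for `B ∈ U(G₁)`, `C ∈ U(G₂)` the element `P(B ⊕ᶠ C)P⁻¹` lies in `U(H)` (`frame_conj_mem_unitaryGroup`).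
Together: the `U(H)`-classes meeting `{P(B ⊕ᶠ b)P⁻¹}` (fixed `b`, `χ_B(b)` a unit) correspond bijectively to the `U(G₁)`-classes of such `B` — the CM reading (`Q′`-side classes
matched with `γ_H` ↔ `U(G₁′)`-classes with `χ = χ_{γ_H.1}`, and the `ncard` identity of `hcnt`) is the sequel file.

## References
* [Rogawski1990] J. D. Rogawski, *Automorphic Representations of Unitary Groups in Three Variables*, Ann. of Math. Stud. 123 (1990): §8.1 Prop. 8.1.3 pp. 110–111; §3.8
  Prop. 3.8.1 (d) p. 30.
* [HornJohnson2013] R. A. Horn, C. R. Johnson, *Matrix Analysis*, 2nd ed. (2013), §2.4.4 (Sylvester equations and block triangularisation).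
-/

set_option autoImplicit false

noncomputable section

open NumberField IsDedekindDomain Matrix Polynomial
open scoped MatrixGroups

namespace Literature.NumberTheory.Rogawski1990

open Literature.NumberTheory.Automorphic Literature.NumberTheory.Automorphic.UnitaryGroup
open Literature.AlgebraicGeometry.ShimuraVarieties (unitaryGroup mem_unitaryGroup_iff)

section Generic

variable {S : Type*} [CommRing S] (σ : S →+* S) {N₁ N₂ : ℕ}

/-- `(A ⊕ᶠ B)(C ⊕ᶠ D) = AC ⊕ᶠ BD`. [folklore] -/
private theorem finSum_mul_finSum₇ (A C : Matrix (Fin N₁) (Fin N₁) S) (B D : Matrix (Fin N₂) (Fin N₂) S) :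
    finSum N₁ N₂ A B * finSum N₁ N₂ C D = finSum N₁ N₂ (A * C) (B * D) := by
  simp only [finSum, Matrix.reindex_apply, Matrix.submatrix_mul_equiv, Matrix.fromBlocks_multiply, Matrix.mul_zero, Matrix.zero_mul,
    add_zero, zero_add]

/-- `1 ⊕ᶠ 1 = 1`. [folklore] -/
private theorem finSum_one_one₇ : finSum N₁ N₂ (1 : Matrix (Fin N₁) (Fin N₁) S) (1 : Matrix (Fin N₂) (Fin N₂) S) = 1 := by
  simp only [finSum, Matrix.fromBlocks_one, Matrix.reindex_apply, Matrix.submatrix_one_equiv]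

/-- `⊕ᶠ` is injective in the pair of blocks. [folklore] -/
private theorem finSum_inj₇ {A C : Matrix (Fin N₁) (Fin N₁) S} {B D : Matrix (Fin N₂) (Fin N₂) S}
    (h : finSum N₁ N₂ A B = finSum N₁ N₂ C D) : A = C ∧ B = D := by
  have h' := (Matrix.reindex finSumFinEquiv finSumFinEquiv).injective h
  rw [Matrix.fromBlocks_inj] at h'
  exact ⟨h'.1, h'.2.2.2⟩

/-- `twistGram` of block-diagonal data is block diagonal. [folklore] -/
private theorem twistGram_finSum_finSum₇ (J₁ t₁ : Matrix (Fin N₁) (Fin N₁) S) (J₂ t₂ : Matrix (Fin N₂) (Fin N₂) S) :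
    twistGram σ (finSum N₁ N₂ J₁ J₂) (finSum N₁ N₂ t₁ t₂) = finSum N₁ N₂ (twistGram σ J₁ t₁) (twistGram σ J₂ t₂) := by
  rw [twistGram_def, transpose_finSum_map, finSum_mul_finSum₇, finSum_mul_finSum₇, twistGram_def, twistGram_def]

/-! ### §1 Frame ⇒ blocks -/

/-- **FRAME ⇒ UNITARY BLOCKS.**  `ᵗ(σP)HP = G₁ ⊕ᶠ G₂`, `γ ∈ U(H)`, `γP = P(B ⊕ᶠ C)` ⇒ `ᵗ(σB)G₁B = G₁` and `ᵗ(σC)G₂C = G₂`. [cite: Rogawski1990, §8.1 Prop. 8.1.3 p. 110] -/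
theorem twistGram_blocks_of_frame (H : Matrix (Fin (N₁ + N₂)) (Fin (N₁ + N₂)) S) {P γ : GL (Fin (N₁ + N₂)) S}
    {G₁ : Matrix (Fin N₁) (Fin N₁) S} {G₂ : Matrix (Fin N₂) (Fin N₂) S} (hP : twistGram σ H P.val = finSum N₁ N₂ G₁ G₂) (hγ : γ ∈ unitaryGroup σ H)
    {B : Matrix (Fin N₁) (Fin N₁) S} {C : Matrix (Fin N₂) (Fin N₂) S} (hγP : γ.val * P.val = P.val * finSum N₁ N₂ B C) :
    twistGram σ G₁ B = G₁ ∧ twistGram σ G₂ C = G₂ := by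
  have h1 : twistGram σ H (γ.val * P.val) = finSum N₁ N₂ G₁ G₂ := by rw [twistGram_unitary_mul σ H hγ, hP]
  rw [hγP, twistGram_mul, hP, ← twistGram_def, twistGram_finSum_finSum₇] at h1
  exact finSum_inj₇ h1

/-- The blocks of `P⁻¹γP = B ⊕ᶠ C` have unit determinants. [cite: Rogawski1990, §8.1 Prop. 8.1.3 p. 110] -/
theorem isUnit_det_blocks_of_frame {P γ : GL (Fin (N₁ + N₂)) S} {B : Matrix (Fin N₁) (Fin N₁) S} {C : Matrix (Fin N₂) (Fin N₂) S}
    (hγP : γ.val * P.val = P.val * finSum N₁ N₂ B C) : IsUnit B.det ∧ IsUnit C.det := by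
  have h1 : ((P⁻¹ * γ * P : GL (Fin (N₁ + N₂)) S) : Matrix (Fin (N₁ + N₂)) (Fin (N₁ + N₂)) S) = finSum N₁ N₂ B C := by
    rw [Units.val_mul, Units.val_mul, Matrix.mul_assoc, hγP, ← Matrix.mul_assoc, Units.inv_mul, Matrix.one_mul]
  have hu : IsUnit (finSum N₁ N₂ B C).det := by rw [← h1]; exact Matrix.isUnits_det_units _
  rw [det_finSum] at hu
  exact ⟨isUnit_of_mul_isUnit_left hu, isUnit_of_mul_isUnit_right hu⟩

/-! ### §2 Rigidity: a conjugator of two block elements with the same regular second block is block diagonal -/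

/-- **BLOCK RIGIDITY.**  `k(B ⊕ᶠ b•1) = (B₂ ⊕ᶠ b•1)k` with `χ_B(b)`, `χ_{B₂}(b)` units ⇒ `k = k₁ ⊕ᶠ k₂` and `k₁B = B₂k₁`. [cite: HornJohnson2013, §2.4.4] -/
theorem exists_finSum_eq_of_mul_finSum_eq {k : Matrix (Fin (N₁ + N₂)) (Fin (N₁ + N₂)) S} {B B₂ : Matrix (Fin N₁) (Fin N₁) S} {b : S}
    (hk : k * finSum N₁ N₂ B (b • (1 : Matrix (Fin N₂) (Fin N₂) S)) = finSum N₁ N₂ B₂ (b • (1 : Matrix (Fin N₂) (Fin N₂) S)) * k)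
    (hχ : IsUnit (B.charpoly.eval b)) (hχ₂ : IsUnit (B₂.charpoly.eval b)) :
    ∃ (k₁ : Matrix (Fin N₁) (Fin N₁) S) (k₂ : Matrix (Fin N₂) (Fin N₂) S), k = finSum N₁ N₂ k₁ k₂ ∧ k₁ * B = B₂ * k₁ := by
  -- blocks of `k` in the `Fin N₁ ⊕ Fin N₂` indexing
  set k' : Matrix (Fin N₁ ⊕ Fin N₂) (Fin N₁ ⊕ Fin N₂) S := Matrix.reindex finSumFinEquiv.symm finSumFinEquiv.symm k with hk'
  have hkk : k = Matrix.reindex finSumFinEquiv finSumFinEquiv k' := by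
    rw [hk']; ext i j; simp
  have hk'eq : k' * Matrix.fromBlocks B 0 0 (b • (1 : Matrix (Fin N₂) (Fin N₂) S)) = Matrix.fromBlocks B₂ 0 0 (b • (1 : Matrix (Fin N₂) (Fin N₂) S)) * k' := by
    apply (Matrix.reindex finSumFinEquiv finSumFinEquiv).injective
    have h := hk
    rw [hkk, finSum, finSum, Matrix.reindex_apply, Matrix.reindex_apply, Matrix.reindex_apply, Matrix.submatrix_mul_equiv, Matrix.submatrix_mul_equiv] at h
    rw [Matrix.reindex_apply, Matrix.reindex_apply]
    exact h
  -- read the four blocks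
  rw [← Matrix.fromBlocks_toBlocks k', Matrix.fromBlocks_multiply, Matrix.fromBlocks_multiply, Matrix.fromBlocks_inj] at hk'eq
  obtain ⟨h11, h12, h21, h22⟩ := hk'eq
  simp only [Matrix.mul_zero, Matrix.zero_mul, add_zero, zero_add, Matrix.mul_smul, Matrix.smul_mul, Matrix.mul_one, Matrix.one_mul] at h11 h12 h21 h22
  -- `k₁₂ b = B₂ k₁₂` (column eigenvectors of `B₂`) and `k₂₁ B = b k₂₁` (row eigenvectors of `B`) vanish
  have h21' : k'.toBlocks₂₁ = 0 := eq_zero_of_mul_eq_smul_of_isUnit_eval_charpoly (y := k'.toBlocks₂₁) h21 hχ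
  have h12' : k'.toBlocks₁₂ = 0 := by
    have ht : (k'.toBlocks₁₂)ᵀ * B₂ᵀ = b • (k'.toBlocks₁₂)ᵀ := by
      rw [← Matrix.transpose_mul, ← h12, Matrix.transpose_smul]
    have hχt : IsUnit (B₂ᵀ.charpoly.eval b) := by rwa [Matrix.charpoly_transpose]
    have h0 := eq_zero_of_mul_eq_smul_of_isUnit_eval_charpoly (y := (k'.toBlocks₁₂)ᵀ) ht hχt
    simpa using congrArg Matrix.transpose h0
  refine ⟨k'.toBlocks₁₁, k'.toBlocks₂₂, ?_, h11⟩
  rw [hkk, ← Matrix.fromBlocks_toBlocks k', h12', h21']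
  rfl

/-- **TWO REALISATIONS OF CONJUGATE ELEMENTS HAVE `U(G₁)`-CONJUGATE BLOCKS.**  `ᵗ(σP)HP = G₁ ⊕ᶠ G₂`; `xγx⁻¹·P = P(B ⊕ᶠ b•1)`, `x′γ′x′⁻¹·P = P(B₂ ⊕ᶠ b•1)` with
`x, x′, g ∈ U(H)`, `gγg⁻¹ = γ′`, `χ_B(b)`, `χ_{B₂}(b)` units ⇒ there is `k₁` with `ᵗ(σk₁)G₁k₁ = G₁`, `det k₁` a unit and `k₁B = B₂k₁`.
[cite: Rogawski1990, §8.1 Prop. 8.1.3 pp. 110–111] -/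
theorem exists_unitary_block_conj_of_conj (H : Matrix (Fin (N₁ + N₂)) (Fin (N₁ + N₂)) S) {P : GL (Fin (N₁ + N₂)) S}
    {G₁ : Matrix (Fin N₁) (Fin N₁) S} {G₂ : Matrix (Fin N₂) (Fin N₂) S} (hP : twistGram σ H P.val = finSum N₁ N₂ G₁ G₂)
    {γ γ' x x' g : GL (Fin (N₁ + N₂)) S} (hx : x ∈ unitaryGroup σ H) (hx' : x' ∈ unitaryGroup σ H) (hg : g ∈ unitaryGroup σ H) (hgγ : g * γ * g⁻¹ = γ')
    {B B₂ : Matrix (Fin N₁) (Fin N₁) S} {b : S}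
    (hB : (x * γ * x⁻¹).val * P.val = P.val * finSum N₁ N₂ B (b • (1 : Matrix (Fin N₂) (Fin N₂) S)))
    (hB₂ : (x' * γ' * x'⁻¹).val * P.val = P.val * finSum N₁ N₂ B₂ (b • (1 : Matrix (Fin N₂) (Fin N₂) S)))
    (hχ : IsUnit (B.charpoly.eval b)) (hχ₂ : IsUnit (B₂.charpoly.eval b)) :
    ∃ k₁ : Matrix (Fin N₁) (Fin N₁) S, twistGram σ G₁ k₁ = G₁ ∧ IsUnit k₁.det ∧ k₁ * B = B₂ * k₁ := by
  -- the unitary conjugator `u := x′ g x⁻¹` from `xγx⁻¹` to `x′γ′x′⁻¹`, read in the frame: `k := P⁻¹ u P`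
  obtain ⟨u, hu⟩ : ∃ u : GL (Fin (N₁ + N₂)) S, u = x' * g * x⁻¹ := ⟨_, rfl⟩
  have huU : u ∈ unitaryGroup σ H := by rw [hu]; exact Subgroup.mul_mem _ (Subgroup.mul_mem _ hx' hg) (Subgroup.inv_mem _ hx)
  have huc : u * (x * γ * x⁻¹) * u⁻¹ = x' * γ' * x'⁻¹ := by
    rw [hu, ← hgγ]; group
  set k : Matrix (Fin (N₁ + N₂)) (Fin (N₁ + N₂)) S := ((P⁻¹ * u * P : GL (Fin (N₁ + N₂)) S) : Matrix (Fin (N₁ + N₂)) (Fin (N₁ + N₂)) S) with hkdef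
  -- `k (B ⊕ᶠ b) = (B₂ ⊕ᶠ b) k`
  have hframe : ∀ {δ : GL (Fin (N₁ + N₂)) S} {D : Matrix (Fin (N₁ + N₂)) (Fin (N₁ + N₂)) S}, δ.val * P.val = P.val * D →
      ((P⁻¹ * δ * P : GL (Fin (N₁ + N₂)) S) : Matrix (Fin (N₁ + N₂)) (Fin (N₁ + N₂)) S) = D := by
    intro δ D h
    rw [Units.val_mul, Units.val_mul, Matrix.mul_assoc, h, ← Matrix.mul_assoc, Units.inv_mul, Matrix.one_mul]
  have hk : k * finSum N₁ N₂ B (b • (1 : Matrix (Fin N₂) (Fin N₂) S)) = finSum N₁ N₂ B₂ (b • (1 : Matrix (Fin N₂) (Fin N₂) S)) * k := by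
    rw [hkdef, ← hframe hB, ← hframe hB₂, ← Units.val_mul, ← Units.val_mul]
    congr 1
    rw [← huc]; group
  obtain ⟨k₁, k₂, hk12, hk₁⟩ := exists_finSum_eq_of_mul_finSum_eq hk hχ hχ₂
  -- `k` is unitary for `G₁ ⊕ᶠ G₂` (it is `P⁻¹uP` with `u ∈ U(H)`), hence `k₁ ∈ U(G₁)`; and invertible
  have hkU : twistGram σ (finSum N₁ N₂ G₁ G₂) k = finSum N₁ N₂ G₁ G₂ := by
    have e1 : P.val * k = u.val * P.val := by
      rw [hkdef, Units.val_mul, Units.val_mul, ← Matrix.mul_assoc, ← Matrix.mul_assoc, Units.mul_inv, Matrix.one_mul]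
    rw [← hP, twistGram_def σ (twistGram σ H P.val) k, ← twistGram_mul, e1, twistGram_unitary_mul σ H huU]
  rw [hk12, twistGram_finSum_finSum₇] at hkU
  have hdet : IsUnit k.det := by rw [hkdef]; exact Matrix.isUnits_det_units _
  rw [hk12, det_finSum] at hdet
  exact ⟨k₁, (finSum_inj₇ hkU).1, isUnit_of_mul_isUnit_left hdet, hk₁⟩

/-! ### §3 Blocks ⇒ element -/

/-- **UNITARY BLOCKS IN A FRAME GIVE A UNITARY ELEMENT**: `ᵗ(σP)HP = G₁ ⊕ᶠ G₂`, `ᵗ(σB)G₁B = G₁`, `ᵗ(σC)G₂C = G₂`, `T = B ⊕ᶠ C` invertible ⇒ `PTP⁻¹ ∈ U(H)`.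
[cite: Rogawski1990, §8.1 Prop. 8.1.3 p. 110] -/
theorem frame_conj_mem_unitaryGroup (H : Matrix (Fin (N₁ + N₂)) (Fin (N₁ + N₂)) S) {P T : GL (Fin (N₁ + N₂)) S}
    {G₁ : Matrix (Fin N₁) (Fin N₁) S} {G₂ : Matrix (Fin N₂) (Fin N₂) S} (hP : twistGram σ H P.val = finSum N₁ N₂ G₁ G₂)
    {B : Matrix (Fin N₁) (Fin N₁) S} {C : Matrix (Fin N₂) (Fin N₂) S} (hT : T.val = finSum N₁ N₂ B C)
    (hB : twistGram σ G₁ B = G₁) (hC : twistGram σ G₂ C = G₂) : P * T * P⁻¹ ∈ unitaryGroup σ H := by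
  rw [← twistGram_coe_eq_iff_mem_unitaryGroup]
  have h1 : twistGram σ H (P.val * T.val) = finSum N₁ N₂ G₁ G₂ := by
    rw [twistGram_mul, hP, hT, ← twistGram_def, twistGram_finSum_finSum₇, hB, hC]
  have h2 : twistGram σ H ((P * T * P⁻¹ : GL (Fin (N₁ + N₂)) S) : Matrix (Fin (N₁ + N₂)) (Fin (N₁ + N₂)) S) =
      twistGram σ (twistGram σ H (P.val * T.val)) ((P⁻¹ : GL (Fin (N₁ + N₂)) S) : Matrix (Fin (N₁ + N₂)) (Fin (N₁ + N₂)) S) := by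
    rw [Units.val_mul, Units.val_mul, twistGram_mul, twistGram_def σ (twistGram σ H _)]
  rw [h2, h1, ← hP, twistGram_def σ (twistGram σ H P.val), ← twistGram_mul, ← Units.val_mul, mul_inv_cancel, Units.val_one, twistGram_one]

end Generic

end Literature.NumberTheory.Rogawski1990

end
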